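import Literature.AnabelianGeometry.AbsoluteAnabelian.NFSlimKummerProofs
import Literature.GroupTheory.LevelwiseConjugacyLimit
import HarnessLib

/-!
# The Neukirch–Uchida deduction, rows R7 + R11: the `ℚ`-core assembled from level-wise conjugators

J. Neukirch, A. Schmidt, K. Wingberg, *Cohomology of Number Fields* (2nd ed.), Thm. (12.2.1)
(Neukirch–Uchida), last step of the proof: once an isomorphism `α : U₁ ⥲ U₂` between open subgroups
of `Γ = G_ℚ` is known to be induced by an inner automorphism of `Γ` MODULO every open normal subgroup
(on a fixed open normal `H ≤ U₁`, i.e. at every finite Galois level — the output of row R10 of the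
abc-iut sub-DAG `plan/L4/SUBDAG-NeukirchUchida.md`), compactness of `Γ` yields one conjugator `τ` on `H`
(`Literature.GroupTheory.LevelwiseConjugacyLimit`, abc-iut-w6-d055) and SLIMNESS of `G_ℚ` ([AbsAnab]
Thm 1.1.1 (ii), `galoisNF_slim_holds`) extends `α = conj τ` from `H` to `U₁` and makes `τ` unique.

Everything here is topological group theory on `Γ = Field.absoluteGaloisGroup ℚ` (profinite and slim);
the statements are INSTANCE-FREE in the number fields (open normal subgroups instead of finite Galois
subextensions) so that the number-theoretic rows plug in by name:

* `exists_openNormal_le` (row R7 (b)): an open `U ≤ Γ` contains an open normal subgroup of `Γ`;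
* `forall_eq_conj_of_forall_mem` (row R7 (a)): `α = conj τ` on an open normal `H ≤ U₁` ⇒ on `U₁`;
* `conj_unique_of_isOpen`: uniqueness of `τ` on an open `U₁`;
* **`exists_forall_eq_conj_of_levelwise`** (row R11): level-wise conjugators on `H` ⇒ a global `τ` with
  `α(u) = τ u τ⁻¹` for all `u ∈ U₁`; `existsUnique_forall_eq_conj_of_levelwise`.

PROOF-ONLY (0 `def`s).  HONEST FRAMING: classical, outside the [IUTchIII] Cor. 3.12 cone; the level-wise
hypothesis `hlev` is row R10's output and is NOT proved here; nothing here takes a side.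

## References
* [NeukirchSchmidtWingberg2008] Neukirch–Schmidt–Wingberg, *Cohomology of Number Fields*, Thm. (12.2.1).
* [MochizukiAbsAnab2004] S. Mochizuki, *The absolute anabelian geometry of hyperbolic curves*, Thm. 1.1.1 (ii) p. 6.
-/

noncomputable section

open scoped Pointwise Topology
open Field

namespace Literature.AnabelianGeometry.AbsoluteAnabelian

namespace NeukirchUchidaProof

/-- **An open subgroup of `G_ℚ` contains an open NORMAL subgroup of `G_ℚ`** (row R7 (b): the absolute
Galois group of a finite Galois `N/ℚ` inside `U`; here via the profinite neighbourhood basis of open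
normal subgroups). [cite: NeukirchSchmidtWingberg2008, Thm (12.2.1)] -/
theorem exists_openNormal_le (U : Subgroup (absoluteGaloisGroup ℚ))
    (hU : IsOpen (U : Set (absoluteGaloisGroup ℚ))) :
    ∃ H : Subgroup (absoluteGaloisGroup ℚ), IsOpen (H : Set (absoluteGaloisGroup ℚ)) ∧ H.Normal ∧
      H ≤ U := by
  obtain ⟨H, hH⟩ := ProfiniteGrp.exist_openNormalSubgroup_sub_open_nhds_of_one hU U.one_mem
  exact ⟨H, H.isOpen, H.isNormal', fun g hg => hH hg⟩

/-- **Extension by slimness** (row R7 (a)): if `α : U₁ ⥲ U₂` agrees with conjugation by `τ` on an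
open normal subgroup `H ≤ U₁` of `Γ = G_ℚ`, then `α` is conjugation by `τ` on all of `U₁` (`G_ℚ` is slim:
the centraliser of the open subgroup `H` is trivial — [AbsAnab] Thm 1.1.1 (ii), `galoisNF_slim_holds`).
[cite: NeukirchSchmidtWingberg2008, Thm (12.2.1)] -/
theorem forall_eq_conj_of_forall_mem (U₁ U₂ : Subgroup (absoluteGaloisGroup ℚ)) (α : U₁ ≃* U₂)
    (H : Subgroup (absoluteGaloisGroup ℚ)) (hHopen : IsOpen (H : Set (absoluteGaloisGroup ℚ)))
    (hHnormal : H.Normal) (hHU : H ≤ U₁) (τ : absoluteGaloisGroup ℚ)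
    (hτ : ∀ (a : absoluteGaloisGroup ℚ) (ha : a ∈ H),
      ((α ⟨a, hHU ha⟩ : U₂) : absoluteGaloisGroup ℚ) = τ * a * τ⁻¹) :
    ∀ u : U₁, ((α u : U₂) : absoluteGaloisGroup ℚ) = τ * u * τ⁻¹ := by
  have hZ : Subgroup.centralizer (H : Set (absoluteGaloisGroup ℚ)) = ⊥ :=
    (galoisNF_slim_holds ℚ).centralizer_eq_bot H hHopen
  intro u
  -- `c = u⁻¹ τ⁻¹ α(u) τ` centralises `H`
  set A : absoluteGaloisGroup ℚ := ((α u : U₂) : absoluteGaloisGroup ℚ) with hA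
  have hc : (u : absoluteGaloisGroup ℚ)⁻¹ * τ⁻¹ * A * τ ∈
      Subgroup.centralizer (H : Set (absoluteGaloisGroup ℚ)) := by
    rw [Subgroup.mem_centralizer_iff]
    intro n hn
    have hn' : n ∈ H := hn
    have hunu : (u : absoluteGaloisGroup ℚ) * n * (u : absoluteGaloisGroup ℚ)⁻¹ ∈ H :=
      hHnormal.conj_mem n hn' u
    -- multiplicativity of `α` on `U₁`
    have hmul : ((α ⟨(u : absoluteGaloisGroup ℚ) * n * (u : absoluteGaloisGroup ℚ)⁻¹, hHU hunu⟩ : U₂) :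
        absoluteGaloisGroup ℚ) = A * ((α ⟨n, hHU hn'⟩ : U₂) : absoluteGaloisGroup ℚ) * A⁻¹ := by
      have e : (⟨(u : absoluteGaloisGroup ℚ) * n * (u : absoluteGaloisGroup ℚ)⁻¹, hHU hunu⟩ : U₁) =
          u * ⟨n, hHU hn'⟩ * u⁻¹ := rfl
      rw [e, map_mul, map_mul, map_inv, hA]
      rfl
    rw [hτ _ hunu, hτ n hn'] at hmul
    -- `τ (u n u⁻¹) τ⁻¹ = A (τ n τ⁻¹) A⁻¹`
    calc n * ((u : absoluteGaloisGroup ℚ)⁻¹ * τ⁻¹ * A * τ)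
        = (u : absoluteGaloisGroup ℚ)⁻¹ * τ⁻¹ *
            (τ * ((u : absoluteGaloisGroup ℚ) * n * (u : absoluteGaloisGroup ℚ)⁻¹) * τ⁻¹) * (A * τ) := by
          group
      _ = (u : absoluteGaloisGroup ℚ)⁻¹ * τ⁻¹ * (A * (τ * n * τ⁻¹) * A⁻¹) * (A * τ) := by rw [hmul]
      _ = (u : absoluteGaloisGroup ℚ)⁻¹ * τ⁻¹ * A * τ * n := by group
  rw [hZ, Subgroup.mem_bot] at hc
  calc A = τ * ((u : absoluteGaloisGroup ℚ) * ((u : absoluteGaloisGroup ℚ)⁻¹ * τ⁻¹ * A * τ)) * τ⁻¹ := by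
        group
    _ = τ * u * τ⁻¹ := by rw [hc, mul_one]

/-- **Uniqueness by slimness**: two conjugators inducing the same map on an open subgroup of `G_ℚ`
coincide. [cite: NeukirchSchmidtWingberg2008, Thm (12.2.1)] -/
theorem conj_unique_of_isOpen (U₁ : Subgroup (absoluteGaloisGroup ℚ))
    (hU₁ : IsOpen (U₁ : Set (absoluteGaloisGroup ℚ))) {τ τ' : absoluteGaloisGroup ℚ}
    (h : ∀ u : U₁, τ * u * τ⁻¹ = τ' * u * τ'⁻¹) : τ = τ' := by
  have hZ : Subgroup.centralizer (U₁ : Set (absoluteGaloisGroup ℚ)) = ⊥ :=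
    (galoisNF_slim_holds ℚ).centralizer_eq_bot U₁ hU₁
  have hc : τ⁻¹ * τ' ∈ Subgroup.centralizer (U₁ : Set (absoluteGaloisGroup ℚ)) := by
    rw [Subgroup.mem_centralizer_iff]
    intro u hu
    have hu' := h ⟨u, hu⟩
    calc u * (τ⁻¹ * τ') = τ⁻¹ * (τ * u * τ⁻¹) * τ' := by group
      _ = τ⁻¹ * (τ' * u * τ'⁻¹) * τ' := by rw [hu']
      _ = τ⁻¹ * τ' * u := by group
  rw [hZ, Subgroup.mem_bot] at hc
  calc τ = τ * (τ⁻¹ * τ') := by rw [hc, mul_one]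
    _ = τ' := by group

/-- **The `ℚ`-core of Neukirch–Uchida from level-wise conjugacy** (rows R10 ⇒ R11 ⇒ R7): let
`α : U₁ ⥲ U₂` be an isomorphism between subgroups of `Γ = G_ℚ` and `H ≤ U₁` an OPEN NORMAL subgroup
of `Γ` (the absolute Galois group of a finite Galois `N/ℚ`).  If for every open normal `W ≤ H` of `Γ`
(every finite Galois `M ⊇ N`) there is `τ_W ∈ Γ` with `α(a) ≡ τ_W a τ_W⁻¹ (mod W)` for all `a ∈ H` (the
level-`M` conjugators of row R10), then ONE `τ ∈ Γ` has `α(u) = τ u τ⁻¹` for all `u ∈ U₁`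
(compactness: `Literature.GroupTheory.LevelwiseConjugacyLimit`; slimness:
`forall_eq_conj_of_forall_mem`). [cite: NeukirchSchmidtWingberg2008, Thm (12.2.1)] -/
theorem exists_forall_eq_conj_of_levelwise (U₁ U₂ : Subgroup (absoluteGaloisGroup ℚ)) (α : U₁ ≃* U₂)
    (H : Subgroup (absoluteGaloisGroup ℚ)) (hHopen : IsOpen (H : Set (absoluteGaloisGroup ℚ)))
    (hHnormal : H.Normal) (hHU : H ≤ U₁)
    (hlev : ∀ W : Subgroup (absoluteGaloisGroup ℚ), IsOpen (W : Set (absoluteGaloisGroup ℚ)) →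
      W.Normal → W ≤ H → ∃ τ : absoluteGaloisGroup ℚ, ∀ (a : absoluteGaloisGroup ℚ) (ha : a ∈ H),
        (((α ⟨a, hHU ha⟩ : U₂) : absoluteGaloisGroup ℚ))⁻¹ * (τ * a * τ⁻¹) ∈ W) :
    ∃ τ : absoluteGaloisGroup ℚ, ∀ u : U₁, ((α u : U₂) : absoluteGaloisGroup ℚ) = τ * u * τ⁻¹ := by
  -- the partial map `σ : H → Γ`, `h ↦ α(h)`
  let σ : H → absoluteGaloisGroup ℚ := fun h => ((α ⟨(h : absoluteGaloisGroup ℚ), hHU h.2⟩ : U₂) :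
    absoluteGaloisGroup ℚ)
  have key : ∃ τ : absoluteGaloisGroup ℚ, ∀ h : H, σ h = τ * h * τ⁻¹ := by
    refine Literature.GroupTheory.LevelwiseConjugacyLimit.exists_forall_eq_conj_of_forall_openNormalSubgroup_subgroup
      H σ fun W => ?_
    -- shrink the level to `W ⊓ H`, an open normal subgroup of `Γ` inside `H`
    have hWH : IsOpen ((W : Subgroup (absoluteGaloisGroup ℚ)) ⊓ H : Set (absoluteGaloisGroup ℚ)) :=
      W.isOpen.inter hHopen
    haveI : (W : Subgroup (absoluteGaloisGroup ℚ)).Normal := W.isNormal'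
    have hWHn : ((W : Subgroup (absoluteGaloisGroup ℚ)) ⊓ H).Normal := inferInstance
    obtain ⟨τ, hτ⟩ := hlev _ hWH hWHn inf_le_right
    exact ⟨τ, fun h => (hτ h h.2).1⟩
  obtain ⟨τ, hτ⟩ := key
  exact ⟨τ, forall_eq_conj_of_forall_mem U₁ U₂ α H hHopen hHnormal hHU τ fun a ha => hτ ⟨a, ha⟩⟩

/-- The `ℚ`-core with UNIQUENESS of the conjugator (`U₁` open, slimness).
[cite: NeukirchSchmidtWingberg2008, Thm (12.2.1)] -/
theorem existsUnique_forall_eq_conj_of_levelwise (U₁ U₂ : Subgroup (absoluteGaloisGroup ℚ))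
    (hU₁ : IsOpen (U₁ : Set (absoluteGaloisGroup ℚ))) (α : U₁ ≃* U₂)
    (H : Subgroup (absoluteGaloisGroup ℚ)) (hHopen : IsOpen (H : Set (absoluteGaloisGroup ℚ)))
    (hHnormal : H.Normal) (hHU : H ≤ U₁)
    (hlev : ∀ W : Subgroup (absoluteGaloisGroup ℚ), IsOpen (W : Set (absoluteGaloisGroup ℚ)) →
      W.Normal → W ≤ H → ∃ τ : absoluteGaloisGroup ℚ, ∀ (a : absoluteGaloisGroup ℚ) (ha : a ∈ H),
        (((α ⟨a, hHU ha⟩ : U₂) : absoluteGaloisGroup ℚ))⁻¹ * (τ * a * τ⁻¹) ∈ W) :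
    ∃! τ : absoluteGaloisGroup ℚ, ∀ u : U₁, ((α u : U₂) : absoluteGaloisGroup ℚ) = τ * u * τ⁻¹ := by
  obtain ⟨τ, hτ⟩ := exists_forall_eq_conj_of_levelwise U₁ U₂ α H hHopen hHnormal hHU hlev
  refine ⟨τ, hτ, fun τ' hτ' => (conj_unique_of_isOpen U₁ hU₁ fun u => ?_)⟩
  rw [← hτ u, ← hτ' u]

end NeukirchUchidaProof

end Literature.AnabelianGeometry.AbsoluteAnabelian

end
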